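import Literature.NumberTheory.Weil1964.AdelicDoublingDeltaOriginValue
import Literature.NumberTheory.GelbartRogawski1991.UnitaryDualPairSplittingDatum
import Literature.NumberTheory.Li1992.RallisInnerProductThetaLift
import HarnessLib

/-!
# Crux H413, E-2 Siegel–Weil sub-line `F0_E2SiegelWeilWeilRange`: the stub SW4 (the section value at the origin) CLOSED —
# a by-name closer for `Cruxes/H413/Lines/F0_E2SiegelWeilWeilRange.lean` (A-p17 (g13), ED. 4 04e07c34 ∕ ED. 5 707bc7a8)

HC_CM is proved only modulo the printed citations until rung 0 closes.  Cell `hodgecm-mathlib`, programme P4, engine E-2,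
child line typed by A-p17 (g13); item stmt-HodgeConjecture-24833; hand A-p12 (g12) (re-deal s417 ∕ F0P4-plan (g3) 01:10:23Z,
E-2 lead handoff `F0/P4/E2-LEAD-HANDOFF.v1` §1).  This file states the stub TYPE `StubSW4` of the line file VERBATIM (with the
line's in-file definitions `ev0` and `boxConj` unfolded to their bodies — a Theorems file cannot import a Lines file) and proves it
from the Literature core ★ `Weil1964/AdelicDoublingDeltaOriginValue`:

* `sw4_sectionValue : ‹StubSW4›` — **the section value at the origin** [Li1992, (13) p. 182; (25) p. 184 «`F_φ(1) = ⟨φ₁, φ₂⟩`»]: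
  for every additive Haar measure `ν_X` on `X(𝔸) = 𝔸_Fⁿ` there is `c₀ > 0` (namely `c₀ = ν_X(D^n)⁻¹`, `D^n` the Tate box
  `piFundamentalDomain`, `0 < ν_X(D^n) < ∞` by ★ `measure_piFundamentalDomain_toReal_pos`) with
  `ev₀(Φ₁ ⊠ Φ̄₂) = c₀ · ⟨Φ₁, Φ₂⟩_{ν_X}` for all `Φ₁ Φ₂ ∈ 𝒮(𝔸_Fⁿ)`, where `ev₀(Ψ) = (ω□(r_F δ) Ψ)(0)` is the Siegel–Weil section of the
  diagonal Siegel parabolic at the identity read through Li's rational `δ` (★ `doublingDeltaLift F 𝕋₀ _ = ratThetaLiftCont F 𝕋 _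
  (doublingDeltaRat F)` by `rfl`, `𝕋 = doubledGramFin F (adelicGram F e T_V T_W)`), `Φ₁ ⊠ Φ̄₂ = piSBReindex F finSumFinEquiv
  (tensorToSum Φ₁ (piSchwartzBruhatConj Φ₂))`, and `⟨Φ₁, Φ₂⟩_{ν_X} = ∫ Φ₁ Φ̄₂ dν_X` is ★ `Li1992.schwartzPairing`.  It is ★
  `Weil1964.measure_mul_omega_ratThetaLiftCont_doublingDeltaRat_boxConj_apply_zero` («`ν(D^n) · (ω(r_F δ)(R_e(φ₁ ⊠ φ̄₂)))(0) = ∫ φ₁ φ̄₂ dν`»)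
  at `S := 𝕋`, `T₀ := gram e T_V T_W` (`hS` from ★ `adelicGram_eq_map : adelicGram = (gram).map (algebraMap F 𝔸_F)`), divided by `ν_X(D^n)`.
  No splitting, no `E`: pure `Weil1964` doubling.

The fold in the line file is `theorem stub_SW4_sectionValue : StubSW4 := E2SWSectionValue.sw4_sectionValue` (definitional unfolding of the two
in-file `def`s `ev0`, `boxConj`).

## References
[Li1992] (13) p. 181–182, (25) p. 184 · [HarrisKudlaSweet1996] §1 (1.5), (1.16) p. 952 · [Weil1964] Chap. III n° 40 p. 190 · [Weil1965] n° 39 (30).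
-/

set_option autoImplicit false

noncomputable section

-- Mathlib's measure ∕ quotient APIs are stated across semireducible wrappers (as in the line file).
set_option backward.isDefEq.respectTransparency false
set_option linter.dupNamespace false

namespace Summit.HodgeConjecture.HodgeConjecture.Cruxes.H413.E2SWSectionValue

open scoped Matrix ComplexConjugate ENNReal
open _root_.MeasureTheory NumberField
open Literature.RepresentationTheory.HeisenbergGroup
open Literature.NumberTheory.Weil1964 Literature.NumberTheory.Automorphic
open Literature.NumberTheory.GelbartRogawski1991 Literature.NumberTheory.GelbartRogawski1991.UnitaryDualPair
open Literature.NumberTheory.Li1992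

/-- **SW4 — THE SECTION VALUE AT THE ORIGIN** (the line's `StubSW4`, verbatim with `ev0`∕`boxConj` unfolded): for every additive Haar
measure `ν_X` on `𝔸_Fⁿ` there is `c₀ > 0` (`= ν_X(D^n)⁻¹`) with `(ω□(r_F δ)(Φ₁ ⊠ Φ̄₂))(0) = c₀ · ⟨Φ₁, Φ₂⟩_{ν_X}` for all
`Φ₁ Φ₂ ∈ 𝒮(𝔸_Fⁿ)` — Li's (13) «`F_φ(1) = ⟨φ₁, φ₂⟩`» up to the Haar normalisation (`c₀ = 1` for the Tamagawa measure, `ν_X(D^n) = 1`).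
[cite: Li1992, (13) p. 182 and (25) p. 184] [cite: HarrisKudlaSweet1996, (1.16) p. 952] -/
theorem sw4_sectionValue :
  ∀ (F : Type) [Field F] [NumberField F] (N : ℕ) {n : ℕ} (e : Fin N × Fin 1 ≃ Fin n)
    {TV : Matrix (Fin N) (Fin N) F} {TW : Matrix (Fin 1) (Fin 1) F} (hVd : IsUnit TV.det) (hWd : IsUnit TW.det)
    [MeasurableSpace (AdeleRing (𝓞 F) F)] [BorelSpace (AdeleRing (𝓞 F) F)]
    (νX : Measure (Fin n → AdeleRing (𝓞 F) F)) [νX.IsAddHaarMeasure],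
    ∃ c₀ : ℝ, 0 < c₀ ∧ ∀ (Φ₁ Φ₂ : piSchwartzBruhat F (Fin n)),
      ((adelicMpCont.omega F (Fin (n + n)) (doubledGramFin F (adelicGram F e TV TW))
          (doublingDeltaLift F (adelicGram F e TV TW) (isUnit_det_adelicGram F e hVd hWd))
          (piSBReindex F finSumFinEquiv (tensorToSum F (Fin n) (Fin n) Φ₁ (piSchwartzBruhatConj F (Fin n) Φ₂))) :
          piSchwartzBruhat F (Fin (n + n))) : (Fin (n + n) → AdeleRing (𝓞 F) F) → ℂ) 0 =
        (c₀ : ℂ) * schwartzPairing F (Fin n) νX Φ₁ Φ₂ := by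
  intro F _ _ N n e TV TW hVd hWd _ _ νX _
  have hpos : 0 < (νX (piFundamentalDomain F (Fin n))).toReal := measure_piFundamentalDomain_toReal_pos
  refine ⟨((νX (piFundamentalDomain F (Fin n))).toReal)⁻¹, inv_pos.2 hpos, fun Φ₁ Φ₂ => ?_⟩
  -- ★ Li (13) at `S := 𝕋 = doubledGramFin F (adelicGram F e T_V T_W)`, `T₀ := gram e T_V T_W`; `doublingDeltaLift` unfolds by `rfl`.
  have key :
      ((νX (piFundamentalDomain F (Fin n))).toReal : ℂ) *
          ((adelicMpCont.omega F (Fin (n + n)) (doubledGramFin F (adelicGram F e TV TW))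
              (doublingDeltaLift F (adelicGram F e TV TW) (isUnit_det_adelicGram F e hVd hWd))
              (piSBReindex F finSumFinEquiv
                (tensorToSum F (Fin n) (Fin n) Φ₁ (piSchwartzBruhatConj F (Fin n) Φ₂))) :
              piSchwartzBruhat F (Fin (n + n))) : (Fin (n + n) → AdeleRing (𝓞 F) F) → ℂ) 0 =
        ∫ u, (Φ₁ : (Fin n → AdeleRing (𝓞 F) F) → ℂ) u * conj ((Φ₂ : (Fin n → AdeleRing (𝓞 F) F) → ℂ) u) ∂νX :=
    measure_mul_omega_ratThetaLiftCont_doublingDeltaRat_boxConj_apply_zero F νX (gram F e TV TW)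
      ((Matrix.isUnit_iff_isUnit_det _).2 (isUnit_det_gram F e hVd hWd))
      (congrArg (doubledGramFin F) (adelicGram_eq_map F e TV TW))
      (isUnit_det_doubledGramFin F _ (isUnit_det_adelicGram F e hVd hWd)) Φ₁ Φ₂
  -- divide by `ν_X(D^n) ≠ 0` (a scalar identity stated on atoms, so that no tactic normalises the heavy `ω`-term).
  have hm : ((νX (piFundamentalDomain F (Fin n))).toReal : ℂ) ≠ 0 := Complex.ofReal_ne_zero.2 hpos.ne'
  have scal : ∀ z I : ℂ, ((νX (piFundamentalDomain F (Fin n))).toReal : ℂ) * z = I →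
      z = (((νX (piFundamentalDomain F (Fin n))).toReal⁻¹ : ℝ) : ℂ) * I := by
    intro z I h
    rw [Complex.ofReal_inv]
    exact (eq_inv_mul_iff_mul_eq₀ hm).2 h
  rw [schwartzPairing_apply]
  exact scal _ _ key

end Summit.HodgeConjecture.HodgeConjecture.Cruxes.H413.E2SWSectionValue

end
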